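/-
Copyright: the b2b-balaban cell (near-miss cell 7), T⁴-continuum fan-out, NE7b ROUND-2 swarm seat
`t4-ne7b-formalise-leaf-06` (row S5 «H2c (+ caps)» of the lineage `t4-ne7b-p1` claim table `LEAVES-NE7b.md`).
Released under the licence of the surrounding project.
-/
import Literature.MathematicalPhysics.QuantumFieldTheory.Balaban1983to89.T4CanonicalMenus

/-!
# History caps (leaf H2c, the «+ caps» half): the class cap and the fuel cap READ OFF the finite live data

Summits-side support leaf of the T⁴-continuum cell (rung (B)+1 on a FINITE torus only; NOT infinite volume, NOT the
mass gap, NOT the Clay statement; NOT a proof of the spine estimate NE7b).  Row S5 of the ROUND-2 swarm table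
`t4/b2b-balaban-t4-ne7b-p1/LEAVES-NE7b.md`; the typer's mirror `t4/formal/NE7b/LEAVES.md` v2.1 books on H2c, next to the
chronology, the two CAPS that `T4CanonicalMenus.mem_canonFam_of_chrono` asks per live member — birth classes
`(sh e).fat < Dcap K` and `fuel G′ ≤ Ncap K` (fields `fat_lt` ∕ `fuel_le` of the assembler's `HistoryAssemblyTerms.TermReading`).
[folklore] finite combinatorics (`Finset.sup`); nothing quoted from print, nothing printed asserted, no `[cite:]` tag; the
two `def`s are ℕ-valued functions of the data (no `Prop` fact, trigger condition c1).

WHY THIS IS ENOUGH.  In the TH exit `CountThresholdExit.relWeightBound_lateMergers_of_irThreshold` the caps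
`(Dcap Ncap : ℕ → ℕ)` are FREE PARAMETERS (l.250): the menu budgets are discharged inside uniformly in `Dcap`
(`T4CanonicalMenus.sum_dictB_rho_le` ∕ `sum_dictB_eta_le`, geometric in the class) and the tree count is uniform in the fuel
`Ncap` (`HistoryAssemblyTrees`, header: «the budget is uniform in both»).  So the assembler may choose them AS FUNCTIONS OF
THE CUTOFF READ OFF ITS OWN FINITE DATA: at each `K` the terms `T K` form a `Finset`, each term's live members `mem K τ` form
a `Finset`, each member's events form a `Finset` — hence the largest birth class and the largest fuel occurring at cutoff
`K` exist, and taking them (plus one) as `Dcap K`, `Ncap K` makes the two cap fields TRUE BY CONSTRUCTION.  No geometric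
input (torus side, region sizes) is needed for the caps; the geometric layer (row S1b) stays owed for what it is really
for — root cells, contact, pending — not for `fat_lt` ∕ `fuel_le`.  (A geometric `Dcap K` = torus side in `MR`-units, as
`HistoryTables`∕`HistorySlots.ClassLT` prepare it, remains a valid alternative choice; the exit does not care which.)

WHAT.  §1 `ncapOf T mem K` (the largest fuel of a live member at `K`) with **`fuel_le_ncapOf`**; `dcapOf sh T mem K` (one
more than the largest class of any label of a live member at `K`) with **`fat_lt_dcapOf`** (all events, a fortiori the
birth-shaped ones).  §2 the two facts in the quantifier shape of `TermReading.fuel_le` ∕ `fat_lt`, over ALL terms of `T K`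
(the bad terms are a sub-family: `badTerms mem jstar T K ⊆ T K` by `Finset.filter_subset`): **`fuel_le_of_mem`**,
**`fat_lt_of_mem`**, `caps_of_subfamily`.  §3 sanity (decided on toy data).

HONEST DEPENDENCY (cell): continuum YM on T⁴ ⇐ BetaPertH ∧ nine spine estimates (0/9 proved); BetaPertH ⇐ (D1) ∧ (D4)
∧ CAP+tail.  This file changes none of it.  NE7b discharge: no date.
-/

open Finset
open Literature.MathematicalPhysics.QuantumFieldTheory.Balaban1983to89
open T4PersistenceDictionary T4CanonicalMenus

namespace Summit.QuantumFields.BalabanUV.T4Continuum.HistoryCaps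

variable {ι γ ε : Type*}

/-! ## §1 The caps read off the data -/

/-- **THE FUEL CAP READ OFF THE DATA**: the largest fuel of a live member of a term at cutoff `K`. [folklore] -/
def ncapOf (T : ℕ → Finset ι) (mem : ℕ → ι → Finset (γ × Gen ε)) (K : ℕ) : ℕ :=
  (T K).sup fun τ => (mem K τ).sup fun q => fuel q.2

/-- every live member's fuel is within the fuel cap read off the data [folklore] -/
theorem fuel_le_ncapOf (T : ℕ → Finset ι) (mem : ℕ → ι → Finset (γ × Gen ε)) {K : ℕ} {τ : ι} (hτ : τ ∈ T K)
    {q : γ × Gen ε} (hq : q ∈ mem K τ) : fuel q.2 ≤ ncapOf T mem K :=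
  (Finset.le_sup (f := fun q : γ × Gen ε => fuel q.2) hq).trans
    (Finset.le_sup (f := fun τ => (mem K τ).sup fun q => fuel q.2) hτ)

variable [DecidableEq ε]

/-- **THE CLASS CAP READ OFF THE DATA**: one more than the largest class `(sh e).fat` of any label of any live member of
a term at cutoff `K`. [folklore] -/
def dcapOf (sh : ε → PEv) (T : ℕ → Finset ι) (mem : ℕ → ι → Finset (γ × Gen ε)) (K : ℕ) : ℕ :=
  ((T K).sup fun τ => (mem K τ).sup fun q => q.2.events.sup fun e => (sh e).fat) + 1

/-- every label of every live member has class below the class cap read off the data (in particular the birth-shaped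
labels that `mem_canonFam_of_chrono` asks about) [folklore] -/
theorem fat_lt_dcapOf (sh : ε → PEv) (T : ℕ → Finset ι) (mem : ℕ → ι → Finset (γ × Gen ε)) {K : ℕ} {τ : ι}
    (hτ : τ ∈ T K) {q : γ × Gen ε} (hq : q ∈ mem K τ) {e : ε} (he : e ∈ q.2.events) :
    (sh e).fat < dcapOf sh T mem K := by
  unfold dcapOf
  have h1 : (sh e).fat ≤ q.2.events.sup fun e => (sh e).fat := Finset.le_sup (f := fun e => (sh e).fat) he
  have h2 : (q.2.events.sup fun e => (sh e).fat) ≤ (mem K τ).sup fun q => q.2.events.sup fun e => (sh e).fat :=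
    Finset.le_sup (f := fun q : γ × Gen ε => q.2.events.sup fun e => (sh e).fat) hq
  have h3 : ((mem K τ).sup fun q => q.2.events.sup fun e => (sh e).fat) ≤
      (T K).sup fun τ => (mem K τ).sup fun q => q.2.events.sup fun e => (sh e).fat :=
    Finset.le_sup (f := fun τ => (mem K τ).sup fun q => q.2.events.sup fun e => (sh e).fat) hτ
  omega

/-! ## §2 In the quantifier shape of the assembler's cap fields -/

omit [DecidableEq ε] in
/-- **THE FUEL-CAP FIELD, FOR ALL TERMS** (hence for the bad ones): with `Ncap := ncapOf T mem`,
`∀ K ≥ K₀, ∀ τ ∈ T K, ∀ q ∈ mem K τ, fuel q.2 ≤ Ncap K`. [folklore] -/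
theorem fuel_le_of_mem (T : ℕ → Finset ι) (mem : ℕ → ι → Finset (γ × Gen ε)) (K₀ : ℕ) :
    ∀ K, K₀ ≤ K → ∀ τ ∈ T K, ∀ q ∈ mem K τ, fuel q.2 ≤ ncapOf T mem K :=
  fun _ _ _ hτ _ hq => fuel_le_ncapOf T mem hτ hq

/-- **THE CLASS-CAP FIELD, FOR ALL TERMS** (hence for the bad ones): with `Dcap := dcapOf sh T mem`,
`∀ K ≥ K₀, ∀ τ ∈ T K, ∀ q ∈ mem K τ, ∀ e ∈ q.2.events, (sh e).kind = 0 → (sh e).fat < Dcap K` (the kind hypothesis is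
not even needed). [folklore] -/
theorem fat_lt_of_mem (sh : ε → PEv) (T : ℕ → Finset ι) (mem : ℕ → ι → Finset (γ × Gen ε)) (K₀ : ℕ) :
    ∀ K, K₀ ≤ K → ∀ τ ∈ T K, ∀ q ∈ mem K τ, ∀ e ∈ q.2.events, (sh e).kind = 0 → (sh e).fat < dcapOf sh T mem K :=
  fun _ _ _ hτ _ hq _ he _ => fat_lt_dcapOf sh T mem hτ hq he

/-- the same two fields restricted to any SUB-FAMILY of terms `S K ⊆ T K` (e.g. the bad terms
`HistoryAssemblyTerms.badTerms mem jstar T K = (T K).filter …`), caps still read off the full family [folklore] -/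
theorem caps_of_subfamily (sh : ε → PEv) (T S : ℕ → Finset ι) (hS : ∀ K, S K ⊆ T K)
    (mem : ℕ → ι → Finset (γ × Gen ε)) (K₀ : ℕ) :
    (∀ K, K₀ ≤ K → ∀ τ ∈ S K, ∀ q ∈ mem K τ, fuel q.2 ≤ ncapOf T mem K) ∧
      ∀ K, K₀ ≤ K → ∀ τ ∈ S K, ∀ q ∈ mem K τ, ∀ e ∈ q.2.events, (sh e).kind = 0 → (sh e).fat < dcapOf sh T mem K :=
  ⟨fun K hK τ hτ q hq => fuel_le_of_mem T mem K₀ K hK τ (hS K hτ) q hq,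
    fun K hK τ hτ q hq e he hk => fat_lt_of_mem sh T mem K₀ K hK τ (hS K hτ) q hq e he hk⟩

/-! ## §3 Sanity (decided on toy data) -/

namespace Sanity

/-- two terms at every cutoff; term `0` has one live member (a bare class-`5` birth tagged `0`), term `1` has a renewed
class-`2` region tagged `1`; the shape map reads the tag's class and the structural step [folklore] -/
def T₀ : ℕ → Finset ℕ := fun _ => {0, 1}

/-- the toy shape map: tag `n` ↦ a birth of class `n + 2` at step `0` (only the class matters for the cap) [folklore] -/
def sh₀ : ℕ → PEv := fun n => (0, 0, n + 2)

/-- the toy live members [folklore] -/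
def mem₀ : ℕ → ℕ → Finset (ℕ × Gen ℕ) := fun _ τ =>
  if τ = 0 then {((7 : ℕ), Gen.born (3 : ℕ) 0)} else {((9 : ℕ), Gen.renew (Gen.born (0 : ℕ) 0) 1 2)}

/-- the caps read off the toy data: fuel cap `2` (the renewed member), class cap `5 + 1 = 6` (tag `3` ↦ class `5`)
[folklore] -/
theorem caps_toy : ncapOf T₀ mem₀ 4 = 2 ∧ dcapOf sh₀ T₀ mem₀ 4 = 6 := by decide

/-- … and the renewed member's fuel `2` and the bare birth's class `5` are within them, by the general lemmas [folklore] -/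
example : fuel (Gen.renew (Gen.born (0 : ℕ) 0) 1 2) ≤ ncapOf T₀ mem₀ 4 ∧ (sh₀ 3).fat < dcapOf sh₀ T₀ mem₀ 4 :=
  ⟨fuel_le_ncapOf T₀ mem₀ (K := 4) (τ := 1) (by decide) (q := ((9 : ℕ), Gen.renew (Gen.born (0 : ℕ) 0) 1 2)) (by decide),
    fat_lt_dcapOf sh₀ T₀ mem₀ (K := 4) (τ := 0) (by decide) (q := ((7 : ℕ), Gen.born (3 : ℕ) 0)) (by decide)
      (e := 3) (by decide)⟩

end Sanity

end Summit.QuantumFields.BalabanUV.T4Continuum.HistoryCaps
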